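import Literature.MathematicalPhysics.KineticTheory.RegularStationaryState
import HarnessLib

/-!
# Conditional-equilibrium (canonical, locally microcanonical) states of the infinite hard-sphere gas

Topic `Literature/MathematicalPhysics/StatisticalMechanics`, namespace
`Literature.MathematicalPhysics.StatisticalMechanics`.  DEFINITIONS for the item
`defn-HardSphereGibbsState` (route `UGibbsRigidity`, D3: "CANONICAL hard-sphere Gibbs states
(conditional law in a window given exterior and local particle number / momentum / energy is
microcanonical-uniform on the hard-core-admissible constraint surface) and the statement
'translation-invariant canonical Gibbs ⇒ Gibbs mixture at small packing'"; foreseen layer-2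
children `LocalMicrocanonical → CanonicalToGibbs → URigidity`).

Everything else the item asked for is ALREADY in the tree and is imported, not restated — this is
the infinite-volume hard-sphere track the routes `RelEntropyErgodic` / `UGibbsRigidity` import:
`Literature/Analysis/FluidPDE/InfiniteHardSphereFlow.lean` (configurations
`PointConfig (ℝ^d × ℝ^d)`, `IsHardCore`, `IsTranslationInvariant`, the window superposition
`superposeIn`, `HardCoreIn`, the a-priori measure `maxwellPhaseMeasure β u Λ`, the DLR Gibbs states
`IsHardSphereGibbs ε z β u` — the grand-canonical laws `g_{z,u,β}`) and
`Literature/MathematicalPhysics/KineticTheory/RegularStationaryState.lean` (`PointProcess.density`,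
`PointProcess.specificRelEntropy`, `PointProcess.IsEntropyRegular`, `kineticEnergyDensity`,
the Gibbs mixtures `IsHardSphereGibbsMixture ε μ`, `RegularStationaryState`, `IsMacroErgodicAt`).
(A parallel `d = 3` track built on a chosen Poisson law, `StatisticalMechanics/HardSphereGibbs.lean`
— `HardSphere.IsGibbs`, `HardSphere.specificRelEntropy` —, serves route `LdDrudeFluxGibbsianity`;
it is not used here; unifying the two tracks is a librarian matter.)

## The printed notion (Aizenman–Goldstein–Lebowitz 1978, §2)

For a finite family `X` of extensive quantities on locally finite configurations of
`Γ = ℝᵈ × ℱ` (Def. 2.1–2.3), a state `μ` (Def. 2.5) is *regular* if its conditional laws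
`μ_Λ(· | ω)` in bounded regions given the outside are absolutely continuous w.r.t. the Liouville
measure `ν_Λ = ⊕_N ν₁|_Λ^{×N}/N!` (Def. 2.6); a *Gibbs state w.r.t. `X`* has
`μ_Λ(dξ | ω) = exp(-λ·X(ξ | ω_{Λᶜ})) ν_Λ(dξ)/Norm` (Def. 2.7); and a regular state is a
**conditional-equilibrium (C.E.) state w.r.t. `X`** iff for every `Λ` "the density of
`μ_Λ(dξ|ω)` with respect to `ν_Λ(dξ)` is given, for `μ`-a.e. `ω`, by a function which depends on
`ξ` only through `X(ξ|ω_{Λᶜ})`", `g : ℝ^m × Ω → ℝ` Borel (Def. 2.9, second form, pp. 283–284) —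
equivalently, the conditional probabilities given the exterior AND the values of `X_Λ` are the
microcanonical ensembles (Def. 2.8–2.9).  Hamiltonians with kinetic energy and hard cores are
admitted (Remark 2.1; §5, 3): "Hard core exclusion is also permitted").  A Gibbs state is a C.E.
state; C.E. states are at most convex combinations of Gibbs states (§2(d), p. 285), and for
`X = {H, N}` with kinetic energy this is Thm 5.1 (p. 295) under the conditions "unsaturated",
(5.2), (5.3) (`N = ∞` a.s.).

## Lean rendering (general dimension `d`, diameter `ε`, `X = (N, P, E_kin)`)

* `tupleMomentum x = ∑ᵢ vᵢ`, `tupleKineticEnergy x = ∑ᵢ |vᵢ|²/2` of a thrown tuple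
  `x : Fin k → ℝ^d × ℝ^d` — with `k` itself, the values of AGL's extensive quantities
  `N, ∑p, ∑p²/2m` (§2(a), Examples 1, 3) on the interior configuration (OVY 1993 §4 (C): "the
  energy, momenta and density associated with a configuration").
* `ceWeight ε Λ g Y A = ∑_k (1/k!) ∫ 1_{A ∩ {HardCoreIn ε Λ}}(X) g(k, ∑v, ∑|v|²/2) d(dq|_Λ ⊗ M₁(v)dv)^{⊗k}(x)`,
  `X = superposeIn Λ x Y`: the law in the window with density `g` — a function of the conserved
  quantities only — w.r.t. the Lebesgue ⊗ standard-Maxwellian Poisson reference glued to the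
  boundary condition `Y`, on the hard-core-admissible set.  (The standard Maxwellian reference
  `M₁` replaces AGL's Lebesgue `dp`; the density `e^{-∑|v|²/2}` between them is a function of
  `E_kin`, so "density depending on `ξ` only through `X`" is the same condition; the tree's
  `maxwellPhaseMeasure 1 0 Λ` and `superposeIn` are reused verbatim.)
* `IsHardSphereCEState ε μ` — AGL Def. 2.9 (regularity built in): `μ` is a probability measure
  and for every bounded open `Λ` (AGL's regions, §2(a)) there is a measurable `g ≥ 0` on
  `(ℕ × ℝ^d × ℝ) × configurations` with `μ(A) = ∫ ceWeight ε Λ (g(·, Y|_{Λᶜ})) Y A μ(dY)` for all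
  measurable `A`.  `g` reads the boundary condition only OUTSIDE `Λ`, so `Y ↦ ceWeight …` is a
  version of `μ(A | 𝓕_{Λᶜ})`: given the exterior, the interior is absolutely continuous w.r.t. the
  Poisson–Maxwell reference with density a function of `(N_Λ, P_Λ, E_Λ)` vanishing off the
  hard-core-admissible set — "microcanonical-uniform on the constraint surfaces".
* `windowMomentum Λ ω = ∑_{(q,v) ∈ ω, q ∈ Λ} v` (finitely supported sum, junk `0` when
  infinitely many particles sit in `Λ`) and `momentumDensity μ = 𝔼_μ windowMomentum [0,1)^d`
  (Bochner; the momentum densities `q¹…q³` of OVY §2.3, DSS's `𝕁(P)`), completing the tree's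
  `PointProcess.density` and `kineticEnergyDensity` (the item's "specific density, momentum,
  kinetic energy").
* `HardSphereCEStatesAreGibbsMixtures ε η₀ : Prop` — THE ROUTE'S STATEMENT (`CanonicalToGibbs`;
  NOT a theorem in print in this form): every translation-invariant C.E. state of diameter-`ε`
  spheres of density `< η₀`, finite kinetic-energy density, with a.s. infinitely many particles
  (AGL (5.3)), is a Gibbs mixture (`IsHardSphereGibbsMixture ε`).  The printed ancestor, AGL
  Thm 5.1, is the `X = {H, N}` (no momentum) statement for general Hamiltonians with kinetic energy
  (hard cores permitted) under "unsaturated, (5.2), (5.3)"; for translation-invariant states of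
  finite density saturation means "no room for a further sphere anywhere" (Remark 5.1 (2)),
  impossible at small packing.  (5.2) is not transcribed; the momentum-augmented hard-sphere form
  is the route's and is recorded as a definition of a statement only.

## Proved API (non-vacuity)

`superposeIn_zero`, `hardCoreIn_superposeIn_zero`, `ceWeight_numberZero` (`g = 1[N = 0]` gives
`1_A(Y|_{Λᶜ})`), `isHardSphereCEState_dirac_empty` (the vacuum is a C.E. state),
`IsHardSphereCEState.isProbabilityMeasure`, `HardSphereCEStatesAreGibbsMixtures.anti`, `PointConfig.restrict_empty`.
Not proved here: Gibbs ⇒ C.E. (AGL §2(d); needs the count-measurability of the partition function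
`Y ↦ Z_Λ(Y)`, cf. the 2-d `HardDiskGibbsMeasurability`).

## References

* M. Aizenman, S. Goldstein, J. L. Lebowitz, *Conditional equilibrium and the equivalence of
  microcanonical and grandcanonical ensembles in the thermodynamic limit*, Comm. Math. Phys. 62
  (1978) 279–302: Def. 2.1–2.9 (pp. 281–284), Remark 2.1 (p. 284), §2(d) (p. 285), §5, Remark 5.1,
  Thm 5.1 (pp. 294–295). [AizenmanGoldsteinLebowitz1978]
* S. Olla, S. R. S. Varadhan, H.-T. Yau, Comm. Math. Phys. 155 (1993), §2.3 pp. 529–530, §4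
  (C)–(D) p. 540. [OllaVaradhanYau1993]
* H.-O. Georgii, *Canonical Gibbs Measures*, LNM 760 (1979) (lattice canonical specifications, the
  template named by the route; not transcribed). [Georgii1979]
-/

noncomputable section

open MeasureTheory Set Filter Function
open scoped ENNReal NNReal
open Literature.Analysis.FunctionSpaces Literature.Analysis.FluidPDE
open Literature.MathematicalPhysics.KineticTheory Literature.MathematicalPhysics.KineticTheory.PointProcess

namespace Literature.MathematicalPhysics.StatisticalMechanics

variable {d : Type*} [Fintype d]

local notation "𝔼" => EuclideanSpace ℝ d

/-! ### Conserved quantities of a thrown tuple; momentum in a window -/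

/-- Total momentum `∑ᵢ vᵢ` (mass `1`) of the thrown particles `x = (qᵢ, vᵢ)ᵢ` — AGL's extensive
quantity `∑ p` on the interior configuration. [cite: AizenmanGoldsteinLebowitz1978, §2(a) (pp. 281–282)] -/
def tupleMomentum {k : ℕ} (x : Fin k → 𝔼 × 𝔼) : 𝔼 := ∑ i, (x i).2

/-- Total kinetic energy `∑ᵢ |vᵢ|²/2` of the thrown particles — AGL's `∑ p²/2m`, `m = 1`
(Example 3 of §2(a)). [cite: AizenmanGoldsteinLebowitz1978, §2(a) Example 3 (p. 282)] -/
def tupleKineticEnergy {k : ℕ} (x : Fin k → 𝔼 × 𝔼) : ℝ := ∑ i, ‖(x i).2‖ ^ 2 / 2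

/-- The tuple momentum is measurable (continuous). [folklore] -/
@[fun_prop]
theorem measurable_tupleMomentum (k : ℕ) : Measurable (tupleMomentum (d := d) (k := k)) := by
  unfold tupleMomentum; fun_prop

/-- The tuple kinetic energy is measurable (continuous). [folklore] -/
@[fun_prop]
theorem measurable_tupleKineticEnergy (k : ℕ) :
    Measurable (tupleKineticEnergy (d := d) (k := k)) := by
  unfold tupleKineticEnergy; fun_prop

omit [Fintype d] in
/-- No thrown particle: zero momentum. [folklore] -/
@[simp] theorem tupleMomentum_zero (x : Fin 0 → 𝔼 × 𝔼) : tupleMomentum x = 0 := by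
  simp [tupleMomentum]

/-- No thrown particle: zero kinetic energy. [folklore] -/
@[simp] theorem tupleKineticEnergy_zero (x : Fin 0 → 𝔼 × 𝔼) : tupleKineticEnergy x = 0 := by
  simp [tupleKineticEnergy]

/-- **Momentum in the window `Λ`** of a configuration: `∑_{(q,v) ∈ ω, q ∈ Λ} v ∈ ℝ^d`, a finitely
supported sum (junk `0` when infinitely many particles have position in `Λ`, never the case for a
hard-sphere configuration and bounded `Λ`).  The vector companion of the tree's
`PointProcess.pointSum`. [cite: OllaVaradhanYau1993, §4 (C) (p. 540)] -/
def windowMomentum (Λ : Set 𝔼) (ω : PointConfig (𝔼 × 𝔼)) : 𝔼 :=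
  ∑ᶠ p ∈ (ω : Set (𝔼 × 𝔼)) ∩ Prod.fst ⁻¹' Λ, p.2

omit [Fintype d] in
/-- The vacuum has no momentum anywhere. [folklore] -/
@[simp] theorem windowMomentum_empty (Λ : Set 𝔼) :
    windowMomentum Λ (∅ : PointConfig (𝔼 × 𝔼)) = 0 := by
  have h : ((∅ : PointConfig (𝔼 × 𝔼)) : Set (𝔼 × 𝔼)) ∩ Prod.fst ⁻¹' Λ = ∅ := by
    change (∅ : PointConfig (𝔼 × 𝔼)).carrier ∩ Prod.fst ⁻¹' Λ = ∅
    simp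
  rw [windowMomentum, h]
  simp

/-- **Momentum density** of a law `μ`: the mean momentum of the particles with position in the unit
cube `[0,1)^d`, `𝔼_μ ∑_{q ∈ [0,1)^d} v` (the momentum densities `q¹, q², q³` of OVY 1993 §2.3; DSS
§4.1, `𝕁(P)`); for translation-invariant `μ` the specific momentum.  Bochner integral: junk `0`
unless integrable. Completes the tree's `PointProcess.density` / `kineticEnergyDensity`.
[cite: OllaVaradhanYau1993, §2.3 (p. 529)] -/
def momentumDensity (μ : Measure (PointConfig (𝔼 × 𝔼))) : 𝔼 :=
  ∫ ω, windowMomentum (Torus.unitCube d) ω ∂μ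

/-! ### Superposition with no thrown particle -/

omit [Fintype d] in
/-- With no thrown particle the superposition is the boundary condition outside the window.
[folklore] -/
theorem superposeIn_zero (Λ : Set 𝔼) (x : Fin 0 → 𝔼 × 𝔼) (Y : PointConfig (𝔼 × 𝔼)) :
    superposeIn Λ x Y = Y.restrict (Prod.fst ⁻¹' Λᶜ) := by
  refine PointConfig.ext fun p => ?_
  change p ∈ (superposeIn Λ x Y).carrier ↔ p ∈ (Y.restrict (Prod.fst ⁻¹' Λᶜ)).carrier
  simp only [superposeIn, PointConfig.carrier_restrict, Set.mem_union, Set.mem_inter_iff,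
    Set.mem_range, Set.mem_preimage]
  constructor
  · rintro (⟨⟨i, -⟩, -⟩ | h)
    · exact i.elim0
    · exact h
  · exact fun h => Or.inr h

/-- The hard-core constraint only restricts pairs meeting `Λ`: with no thrown particle it holds
whatever the boundary condition (so the `k = 0` term of every partition sum is the free one).
[cite: Richthammer2007, §3.3 (p. 7)] -/
theorem hardCoreIn_superposeIn_zero (ε : ℝ) (Λ : Set 𝔼) (x : Fin 0 → 𝔼 × 𝔼)
    (Y : PointConfig (𝔼 × 𝔼)) : HardCoreIn ε Λ (superposeIn Λ x Y) := by
  rw [superposeIn_zero]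
  intro p hp q hq _ hpq
  have hp' : p ∈ (Y : Set (𝔼 × 𝔼)) ∩ Prod.fst ⁻¹' Λᶜ := hp
  have hq' : q ∈ (Y : Set (𝔼 × 𝔼)) ∩ Prod.fst ⁻¹' Λᶜ := hq
  rcases hpq with h | h
  · exact absurd h hp'.2
  · exact absurd h hq'.2

/-! ### The conditional-equilibrium weights and states -/

/-- **The law in the window `Λ` with density `g(N, P, E)` on the admissible set**, evaluated on
the event `A` with boundary condition `Y`:
`∑_k (1/k!) ∫ 1_{A ∩ {HardCoreIn ε Λ}}(X) g(k, ∑ᵢvᵢ, ∑ᵢ|vᵢ|²/2) d(dq|_Λ ⊗ M₁(v)dv)^{⊗k}(x)`,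
`X = superposeIn Λ x Y` — AGL's `g(X(ξ|ω_{Λᶜ})) ν_Λ(dξ)` for `X = (N, P, E_kin)` with the hard core
as the constraint (Def. 2.9 with Remark 2.1), the velocity reference being the standard
Maxwellian of the tree's `maxwellPhaseMeasure 1 0 Λ` instead of Lebesgue `dp` (the density between
the two is a function of `E_kin`).  An `ℝ≥0∞`-valued lower Lebesgue integral.
[cite: AizenmanGoldsteinLebowitz1978, Def. 2.9 (pp. 283–284)] -/
def ceWeight (ε : ℝ) (Λ : Set 𝔼) (g : ℕ × 𝔼 × ℝ → ℝ≥0∞) (Y : PointConfig (𝔼 × 𝔼))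
    (A : Set (PointConfig (𝔼 × 𝔼))) : ℝ≥0∞ :=
  ∑' k : ℕ, ((Nat.factorial k : ℝ≥0∞))⁻¹ *
    ∫⁻ x : Fin k → 𝔼 × 𝔼, (A ∩ {X | HardCoreIn ε Λ X}).indicator
        (fun _ => g (k, tupleMomentum x, tupleKineticEnergy x)) (superposeIn Λ x Y)
      ∂(Measure.pi fun _ : Fin k => maxwellPhaseMeasure 1 0 Λ)

/-- **Conditional-equilibrium (canonical, locally microcanonical) state of the hard-sphere gas of
diameter `ε` with respect to particle number, momentum and kinetic energy** — AGL 1978 Def. 2.9 in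
its density form (regularity, Def. 2.6, built in; hard core as constraint, Remark 2.1 and §5 3)):
`μ` is a probability measure on configurations and for every bounded open region `Λ ⊆ ℝ^d` ("Let
`Λ` refer to bounded open subsets of `ℝᵈ`", AGL §2(a) p. 281) there is a measurable `g ≥ 0` such that `μ(A) = ∫ ceWeight ε Λ (g(·, Y|_{Λᶜ})) Y A μ(dY)` for every measurable
`A`: given the configuration outside `Λ`, the configuration inside is absolutely continuous w.r.t.
the Poisson–Maxwell reference with a density depending on it only through `(N_Λ, P_Λ, E_Λ)` and
vanishing off the hard-core-admissible set — "the conditional probabilities with respect to `G_Λ`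
are the microcanonical ensembles".  Every grand-canonical Gibbs state `g_{z,u,β}`
(`IsHardSphereGibbs`) is of this form with `g ∝ z^N e^{-(β-1)E + βu·P - βN|u|²/2}/Z_Λ(Y)`
(AGL §2(d)). [cite: AizenmanGoldsteinLebowitz1978, Def. 2.9 (pp. 283–284) and Remark 2.1] -/
def IsHardSphereCEState (ε : ℝ) (μ : Measure (PointConfig (𝔼 × 𝔼))) : Prop :=
  IsProbabilityMeasure μ ∧
    ∀ Λ : Set 𝔼, IsOpen Λ → Bornology.IsBounded Λ →
      ∃ g : (ℕ × 𝔼 × ℝ) × PointConfig (𝔼 × 𝔼) → ℝ≥0∞, Measurable g ∧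
        ∀ A : Set (PointConfig (𝔼 × 𝔼)), MeasurableSet A →
          μ A = ∫⁻ Y, ceWeight ε Λ (fun t => g (t, Y.restrict (Prod.fst ⁻¹' Λᶜ))) Y A ∂μ

/-- A C.E. state is a probability measure (AGL Def. 2.5).
[cite: AizenmanGoldsteinLebowitz1978, Def. 2.5 (p. 283)] -/
theorem IsHardSphereCEState.isProbabilityMeasure {ε : ℝ} {μ : Measure (PointConfig (𝔼 × 𝔼))}
    (h : IsHardSphereCEState ε μ) : IsProbabilityMeasure μ := h.1

/-! ### Non-vacuity: the vacuum is a conditional-equilibrium state -/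

/-- **The density `1[N_Λ = 0]` reproduces the emptied boundary condition**: for
`g = 1[k = 0]`, `ceWeight ε Λ g Y A = 1_A(Y|_{Λᶜ})` — only the term with no thrown particle
survives, its reference mass is `1` and the hard core in `Λ` is automatic. [folklore] -/
theorem ceWeight_numberZero (ε : ℝ) (Λ : Set 𝔼) (Y : PointConfig (𝔼 × 𝔼))
    (A : Set (PointConfig (𝔼 × 𝔼))) :
    ceWeight ε Λ (fun t => if t.1 = 0 then 1 else 0) Y A =
      A.indicator 1 (Y.restrict (Prod.fst ⁻¹' Λᶜ)) := by
  unfold ceWeight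
  rw [tsum_eq_single 0]
  · -- the `k = 0` term: the density is `1`, the reference mass is `1`, the hard core is automatic
    show ((Nat.factorial 0 : ℕ) : ℝ≥0∞)⁻¹ * ∫⁻ x : Fin 0 → 𝔼 × 𝔼,
        (A ∩ {X | HardCoreIn ε Λ X}).indicator (fun _ : PointConfig (𝔼 × 𝔼) => (1 : ℝ≥0∞))
          (superposeIn Λ x Y) ∂(Measure.pi fun _ : Fin 0 => maxwellPhaseMeasure 1 0 Λ) =
      A.indicator 1 (Y.restrict (Prod.fst ⁻¹' Λᶜ))
    have hconst : ∀ x : Fin 0 → 𝔼 × 𝔼, (A ∩ {X | HardCoreIn ε Λ X}).indicator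
        (fun _ : PointConfig (𝔼 × 𝔼) => (1 : ℝ≥0∞)) (superposeIn Λ x Y) =
          A.indicator 1 (Y.restrict (Prod.fst ⁻¹' Λᶜ)) := by
      intro x
      by_cases hA : superposeIn Λ x Y ∈ A
      · have hmem : superposeIn Λ x Y ∈ A ∩ {X | HardCoreIn ε Λ X} :=
          ⟨hA, hardCoreIn_superposeIn_zero ε Λ x Y⟩
        rw [Set.indicator_of_mem hmem]
        rw [superposeIn_zero] at hA
        rw [Set.indicator_of_mem hA, Pi.one_apply]
      · have hnmem : superposeIn Λ x Y ∉ A ∩ {X | HardCoreIn ε Λ X} := fun h => hA h.1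
        rw [Set.indicator_of_notMem hnmem]
        rw [superposeIn_zero] at hA
        rw [Set.indicator_of_notMem hA]
    rw [lintegral_congr hconst, lintegral_const]
    simp
  · intro k hk
    have hint : ∀ x : Fin k → 𝔼 × 𝔼, (A ∩ {X | HardCoreIn ε Λ X}).indicator
        (fun _ : PointConfig (𝔼 × 𝔼) =>
          if (k, tupleMomentum x, tupleKineticEnergy x).1 = 0 then (1 : ℝ≥0∞) else 0)
        (superposeIn Λ x Y) = 0 := fun x => by
      have h0 : (fun _ : PointConfig (𝔼 × 𝔼) =>
          if (k, tupleMomentum x, tupleKineticEnergy x).1 = 0 then (1 : ℝ≥0∞) else 0) = 0 := by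
        funext X; simp [hk]
      rw [h0, Set.indicator_zero']
      rfl
    simp only [hint, lintegral_zero, mul_zero]

/-- Restricting the vacuum gives the vacuum (dot-notation extension of the tree's `PointConfig`).
[folklore] -/
theorem _root_.Literature.Analysis.FunctionSpaces.PointConfig.restrict_empty {E : Type*}
    [TopologicalSpace E] (s : Set E) : (∅ : PointConfig E).restrict s = ∅ := by
  refine PointConfig.ext fun p => ?_
  change p ∈ (∅ : PointConfig E).carrier ∩ s ↔ p ∈ (∅ : PointConfig E).carrier
  simp

/-- **The vacuum `δ_∅` is a conditional-equilibrium state** (every diameter, every dimension): in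
each window take the density `g = 1[N_Λ = 0]` (ignoring the boundary condition).  [folklore] -/
theorem isHardSphereCEState_dirac_empty (ε : ℝ) :
    IsHardSphereCEState ε (Measure.dirac (∅ : PointConfig (𝔼 × 𝔼))) := by
  refine And.intro inferInstance fun Λ hΛ _ => ?_
  refine ⟨fun t => if t.1.1 = 0 then 1 else 0, ?_, fun A hA => ?_⟩
  · refine Measurable.ite ?_ measurable_const measurable_const
    exact (measurable_fst.comp measurable_fst) (measurableSet_singleton 0)
  · have hW : MeasurableSet (Prod.fst ⁻¹' Λᶜ : Set (𝔼 × 𝔼)) := measurable_fst hΛ.measurableSet.compl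
    have hmeas : Measurable fun Y : PointConfig (𝔼 × 𝔼) =>
        A.indicator (1 : PointConfig (𝔼 × 𝔼) → ℝ≥0∞) (Y.restrict (Prod.fst ⁻¹' Λᶜ)) :=
      (measurable_one.indicator hA).comp (PointConfig.measurable_restrict hW)
    have hF : ∀ Y : PointConfig (𝔼 × 𝔼),
        ceWeight ε Λ (fun t => if (t, Y.restrict (Prod.fst ⁻¹' Λᶜ)).1.1 = 0 then 1 else 0) Y A =
          A.indicator 1 (Y.restrict (Prod.fst ⁻¹' Λᶜ)) := fun Y =>
      ceWeight_numberZero ε Λ Y A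
    simp_rw [hF]
    rw [lintegral_dirac' _ hmeas, Measure.dirac_apply' _ hA, PointConfig.restrict_empty]

/-! ### The route's statement: equivalence of ensembles for the dilute hard-sphere gas -/

/-- **Dilute translation-invariant conditional-equilibrium states are Gibbs mixtures** — the
STATEMENT (a `Prop`; crux `CanonicalToGibbs` of route `UGibbsRigidity`, NOT a printed theorem in
this form): for spheres of diameter `ε`, every translation-invariant C.E. state (w.r.t. number,
momentum, kinetic energy) of density `< η₀`, finite kinetic-energy density and with almost surely
infinitely many particles is a mixture of the grand-canonical Gibbs states `g_{z,u,β}`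
(`IsHardSphereGibbsMixture ε`).  Printed ancestor: AGL 1978 Thm 5.1 — "Let `μ` be a conditional
equilibrium state with respect to `X = {H, N}` … If `μ` is unsaturated and [(5.2), (5.3):
`N_{ℝᵈ}(ω) = ∞` a.s.] then `μ` is a convex combination of Gibbs states" — for general Hamiltonians
with kinetic energy, hard cores permitted, WITHOUT the momentum among the conserved quantities;
for translation-invariant states of finite density "unsaturated" fails only if there is a.s. no
room for a further particle (Remark 5.1 (2)), excluded at small packing.  (5.2) is not transcribed.
[cite: AizenmanGoldsteinLebowitz1978, §5 Thm 5.1 (p. 295) — X = {H,N} version; the momentum-augmented hard-sphere form is the route's, unprinted] -/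
def HardSphereCEStatesAreGibbsMixtures (ε : ℝ) (η₀ : ℝ≥0∞) : Prop :=
  ∀ μ : Measure (PointConfig (𝔼 × 𝔼)), IsHardSphereCEState ε μ → IsTranslationInvariant μ →
    density μ < η₀ → kineticEnergyDensity μ < ∞ →
      (∀ᵐ ω ∂μ, ((ω : PointConfig (𝔼 × 𝔼)) : Set (𝔼 × 𝔼)).Infinite) →
        IsHardSphereGibbsMixture ε μ

/-- The statement is antitone in the density threshold. [folklore] -/
theorem HardSphereCEStatesAreGibbsMixtures.anti {ε : ℝ} {η₀ η₁ : ℝ≥0∞} (hη : η₁ ≤ η₀)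
    (h : HardSphereCEStatesAreGibbsMixtures (d := d) ε η₀) :
    HardSphereCEStatesAreGibbsMixtures (d := d) ε η₁ :=
  fun μ hce hti hρ hE hinf => h μ hce hti (hρ.trans_le hη) hE hinf

end Literature.MathematicalPhysics.StatisticalMechanics

end
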